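import Summits.QuantumFields.YangMills.Theorems.SwapVirialDeficitSectorLaplaceEndGaussShellInterface
import HarnessLib

/-!
# STUB (S-end-G♭) OF SKELETON ➎, N2a SUB-BRICK: the follower one-loop weight at a SLAB hub and a NEARBY chart point is matched to the reference weight `D(p′)`
# (free-hands support of ⟨stmt-QuantumFields-24197⟩ `SwapVirialDeficit.SwapGluedStiffness`; cell ym-idea-1, LEAD g99 23:12Z ruling N2a («det matched to YOUR reference D via
# ✓abs_log_det_gnoFolHessian_sub_le_joint exactly as in ✓mbDensity_shell_ge_ref: θ(δ) vs π∕2, |δ| < s ≤ r_m; η-distance ≤ letters + ‖y⋆‖»); assembler fcl-p3 g48)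

★★ `slabHub_coercive_of_near` ∕ ★★★ `sqrt_det_inv_slabHub_le_ref`: for the reference family `AF` of (I1) at `hubAt 0 1`, ANY follower-Hessian family `A` at a slab hub `hubAt δ 1`
(symmetric, ambient identity) and ANY chart point `η` with `Δ := (122689728·|δ| + 44712000·‖η − gnoBase p′‖)·L⁴ ≤ μ_F∕2`:
`A η` is `(μ_F − Δ)`-coercive (so `det A η > 0`), and `ofReal((√det A η)⁻¹) ≤ ofReal(exp(3|Fol L|·Δ∕μ_F)) · D p′`, `D p′ = ofReal((√det AF(gnoBase p′))⁻¹)` — the (I2) weight.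
With `Δ ≤ μ_F∕(2·3|Fol L|)` the factor is `≤ e^{½}` (memo-ε's `E`-bookkeeping).  This is the det-matching input of N2a (near case) at the slab hub; the shell twin is ✓`mbDensity_shell_ge_ref`.

HONEST LABEL: one sub-brick of N2a; N2a∕N2b, the glue and the assembly of `stub_end_gaussCore`, `stub_core_tip`, ⟨24197⟩ ∕ ⟨24194⟩ OPEN; item of record ⟨24085⟩ aside ∕ untouched;
the Yang–Mills mass gap is NOT proved; no summit is proved by a line.  THEOREMS ONLY (0 `def`, 0 `sorry`), standard axioms, no instances.  Seat ym-line-fcl-p3 g48,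
`--supports stmt-QuantumFields-24197`.  References: [cite: Breitung1994, Lemma 26 (2.102), p. 30]; [cite: Luscher1983, §2]; [folklore].
-/

set_option autoImplicit false
set_option synthInstance.maxSize 1024

noncomputable section

open MeasureTheory Quaternion Set Module Metric
open scoped Quaternion BigOperators ENNReal InnerProductSpace
open Literature.MathematicalPhysics.QuantumLattice
open Literature.MathematicalPhysics.QuantumFieldTheory hiding SU2

namespace Summit.QuantumFields.YangMills.Theorems.SwapVirialDeficit.SectorLaplace

open Summit.QuantumFields.YangMills.Theorems.FemtoTransferGap
open Summit.QuantumFields.YangMills.Theorems.FemtoTransferGap.TT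
open Summit.QuantumFields.YangMills.Theorems.VirialFluxGap.RingDeficit
open Summit.QuantumFields.YangMills.Theorems.SwapVirialDeficit.SwapRing
open Summit.QuantumFields.YangMills.Theorems.SwapVirialDeficit.BlowUpRing

variable {L : ℕ} [NeZero L]

/-- ★★ **COERCIVITY TRANSFER TO A SLAB HUB AND A NEARBY CHART POINT**: `⟪A η v, v⟫ ≥ (μ_F − Δ)·‖v‖²`, `Δ = (122689728|δ| + 44712000‖η − gnoBase p′‖)·L⁴`, for any family `A` with the
ambient identity at `hubAt δ 1` and the reference `AF` of (I1) (✓`abs_gnoFolHessianForm_sub_le_joint` + ✓`gnoFolHessian_coercive_base`). [cite: Luscher1983, §2] -/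
theorem slabHub_coercive_of_near {ε : GnoSign L} (hε : GoodSign ε) {AF : GnoCoord L → GnoFol L →ₗ[ℝ] GnoFol L}
    (hFyy : ∀ η (y : GnoFol L), ⟪AF η y, y⟫_ℝ =
      iteratedFDeriv ℝ 2 (fun y' : GnoFol L => gnoDeficit (fun _ => false) (fun _ => 1) (hubAt 0 1) ε (η + gnoFolEmb y')) 0 (fun _ => y))
    (hamb : ∀ η (y : GnoFol L), ⟪AF η y, y⟫_ℝ = iteratedFDeriv ℝ 2 (gnoDeficit (fun _ => false) (fun _ => 1) (hubAt 0 1) ε) η (fun _ => gnoFolEmb y))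
    {δ : ℝ} {A : GnoCoord L → GnoFol L →ₗ[ℝ] GnoFol L}
    (hambA : ∀ η (y : GnoFol L), ⟪A η y, y⟫_ℝ = iteratedFDeriv ℝ 2 (gnoDeficit (fun _ => false) (fun _ => 1) (hubAt δ 1) ε) η (fun _ => gnoFolEmb y))
    (η : GnoCoord L) (p' : ℝ × ℝ) (v : GnoFol L) :
    ((2304 * (L : ℝ) ^ 6 * (Fintype.card (Fol L) : ℝ))⁻¹ - (122689728 * |δ| + 44712000 * ‖η - gnoBase p'.1 p'.2‖) * (L : ℝ) ^ 4) * ‖v‖ ^ 2 ≤ ⟪A η v, v⟫_ℝ := by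
  have hray := folRay_of_fibreForm (L := L) (hubAt_one_ne_zero 0) ε hFyy
  have hcoer := gnoFolHessian_coercive_base (hubAt_one_ne_zero 0) ε hε.1 hε.2 p'.1 p'.2 hray v
  have eθ : gnoDeficit (fun _ => false) (fun _ => (1 : SU2)) (hubAt δ 1) ε = gnoDeficit (fun _ => false) (fun _ => 1) (angUnit (Real.pi / 2 - Real.arctan δ)) ε :=
    funext fun η => gnoDeficit_hubAt_eq_angUnit _ _ δ ε η
  have eθ' : gnoDeficit (fun _ => false) (fun _ => (1 : SU2)) (hubAt 0 1) ε = gnoDeficit (fun _ => false) (fun _ => 1) (angUnit (Real.pi / 2 - Real.arctan 0)) ε :=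
    funext fun η => gnoDeficit_hubAt_eq_angUnit _ _ 0 ε η
  have hambθ : ∀ η (y : GnoFol L), ⟪A η y, y⟫_ℝ = iteratedFDeriv ℝ 2 (gnoDeficit (fun _ => false) (fun _ => 1) (angUnit (Real.pi / 2 - Real.arctan δ)) ε) η
      (fun _ => gnoFolEmb y) := fun η y => by rw [← eθ]; exact hambA η y
  have hambθ' : ∀ η (y : GnoFol L), ⟪AF η y, y⟫_ℝ = iteratedFDeriv ℝ 2 (gnoDeficit (fun _ => false) (fun _ => 1) (angUnit (Real.pi / 2 - Real.arctan 0)) ε) η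
      (fun _ => gnoFolEmb y) := fun η y => by rw [← eθ']; exact hamb η y
  have hdiff := abs_gnoFolHessianForm_sub_le_joint (fun _ => false) (fun _ => (1 : SU2)) (sin_hubAngle_pos δ).le (sin_hubAngle_pos 0).le ε hambθ hambθ'
    η (gnoBase p'.1 p'.2) v
  have hθθ : |(Real.pi / 2 - Real.arctan δ) - (Real.pi / 2 - Real.arctan 0)| ≤ |δ| := (abs_hubAngle_sub_le δ 0).trans (by rw [sub_zero])
  have hL : (0 : ℝ) < L := by exact_mod_cast NeZero.pos L
  have hΔ : (122689728 * |(Real.pi / 2 - Real.arctan δ) - (Real.pi / 2 - Real.arctan 0)| + 44712000 * ‖η - gnoBase p'.1 p'.2‖) * (L : ℝ) ^ 4 * ‖v‖ ^ 2 ≤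
      (122689728 * |δ| + 44712000 * ‖η - gnoBase p'.1 p'.2‖) * (L : ℝ) ^ 4 * ‖v‖ ^ 2 := by gcongr
  have h2 := (abs_le.1 (hdiff.trans hΔ)).1
  nlinarith [h2, hcoer]

/-- ★★★ **THE SLAB-HUB ONE-LOOP WEIGHT AGAINST THE REFERENCE WEIGHT `D(p′)`**: with `Δ = (122689728|δ| + 44712000‖η − gnoBase p′‖)·L⁴ ≤ μ_F∕2`:
`ofReal((√det A η)⁻¹) ≤ ofReal(exp(3|Fol L|·Δ∕μ_F)) · ofReal((√det AF(gnoBase p′))⁻¹)` (✓`abs_log_det_gnoFolHessian_sub_le_joint`; `det A η > 0` by `slabHub_coercive_of_near`).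
[cite: Breitung1994, Lemma 26 (2.102), p. 30] -/
theorem sqrt_det_inv_slabHub_le_ref {ε : GnoSign L} (hε : GoodSign ε) {AF : GnoCoord L → GnoFol L →ₗ[ℝ] GnoFol L} (hFs : ∀ η, (AF η).IsSymmetric)
    (hFyy : ∀ η (y : GnoFol L), ⟪AF η y, y⟫_ℝ =
      iteratedFDeriv ℝ 2 (fun y' : GnoFol L => gnoDeficit (fun _ => false) (fun _ => 1) (hubAt 0 1) ε (η + gnoFolEmb y')) 0 (fun _ => y))
    (hamb : ∀ η (y : GnoFol L), ⟪AF η y, y⟫_ℝ = iteratedFDeriv ℝ 2 (gnoDeficit (fun _ => false) (fun _ => 1) (hubAt 0 1) ε) η (fun _ => gnoFolEmb y))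
    {δ : ℝ} {A : GnoCoord L → GnoFol L →ₗ[ℝ] GnoFol L} (hAs : ∀ η, (A η).IsSymmetric)
    (hambA : ∀ η (y : GnoFol L), ⟪A η y, y⟫_ℝ = iteratedFDeriv ℝ 2 (gnoDeficit (fun _ => false) (fun _ => 1) (hubAt δ 1) ε) η (fun _ => gnoFolEmb y))
    (η : GnoCoord L) (p' : ℝ × ℝ)
    (hnear : (122689728 * |δ| + 44712000 * ‖η - gnoBase p'.1 p'.2‖) * (L : ℝ) ^ 4 ≤ (2304 * (L : ℝ) ^ 6 * (Fintype.card (Fol L) : ℝ))⁻¹ / 2) :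
    ENNReal.ofReal ((Real.sqrt (LinearMap.det (A η)))⁻¹) ≤
      ENNReal.ofReal (Real.exp ((3 * (Fintype.card (Fol L) : ℝ)) * ((122689728 * |δ| + 44712000 * ‖η - gnoBase p'.1 p'.2‖) * (L : ℝ) ^ 4) /
          (2304 * (L : ℝ) ^ 6 * (Fintype.card (Fol L) : ℝ))⁻¹)) *
        ENNReal.ofReal ((Real.sqrt (LinearMap.det (AF (gnoBase p'.1 p'.2))))⁻¹) := by
  set μ : ℝ := (2304 * (L : ℝ) ^ 6 * (Fintype.card (Fol L) : ℝ))⁻¹ with hμ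
  have hμ0 : 0 < μ := (folMu_pos_le (L := L)).1
  have hL : (0 : ℝ) < L := by exact_mod_cast NeZero.pos L
  set Δ : ℝ := (122689728 * |δ| + 44712000 * ‖η - gnoBase p'.1 p'.2‖) * (L : ℝ) ^ 4 with hΔ
  have hΔ0 : 0 ≤ Δ := by positivity
  have hray := folRay_of_fibreForm (L := L) (hubAt_one_ne_zero 0) ε hFyy
  -- positivity of both determinants
  have hdet' : μ ^ finrank ℝ (GnoFol L) ≤ LinearMap.det (AF (gnoBase p'.1 p'.2)) := det_gnoFolHessian_base_ge (hubAt_one_ne_zero 0) ε hε.1 hε.2 p'.1 p'.2 hFs hray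
  have hdpos' : 0 < LinearMap.det (AF (gnoBase p'.1 p'.2)) := lt_of_lt_of_le (by positivity) hdet'
  have hcoerA : ∀ v : GnoFol L, (μ / 2) * ‖v‖ ^ 2 ≤ ⟪A η v, v⟫_ℝ := fun v => by
    have h := slabHub_coercive_of_near (L := L) hε hFyy hamb hambA η p' v
    nlinarith [h, hnear, sq_nonneg ‖v‖]
  have hdet : (μ / 2) ^ finrank ℝ (GnoFol L) ≤ LinearMap.det (A η) := det_ge_pow_of_coercive (hAs η) (by positivity) hcoerA
  have hdpos : 0 < LinearMap.det (A η) := lt_of_lt_of_le (by positivity) hdet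
  -- the joint one-loop comparison
  have eθ : gnoDeficit (fun _ => false) (fun _ => (1 : SU2)) (hubAt δ 1) ε = gnoDeficit (fun _ => false) (fun _ => 1) (angUnit (Real.pi / 2 - Real.arctan δ)) ε :=
    funext fun η => gnoDeficit_hubAt_eq_angUnit _ _ δ ε η
  have eθ' : gnoDeficit (fun _ => false) (fun _ => (1 : SU2)) (hubAt 0 1) ε = gnoDeficit (fun _ => false) (fun _ => 1) (angUnit (Real.pi / 2 - Real.arctan 0)) ε :=
    funext fun η => gnoDeficit_hubAt_eq_angUnit _ _ 0 ε η
  have hambθ : ∀ η (y : GnoFol L), ⟪A η y, y⟫_ℝ = iteratedFDeriv ℝ 2 (gnoDeficit (fun _ => false) (fun _ => 1) (angUnit (Real.pi / 2 - Real.arctan δ)) ε) η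
      (fun _ => gnoFolEmb y) := fun η y => by rw [← eθ]; exact hambA η y
  have hambθ' : ∀ η (y : GnoFol L), ⟪AF η y, y⟫_ℝ = iteratedFDeriv ℝ 2 (gnoDeficit (fun _ => false) (fun _ => 1) (angUnit (Real.pi / 2 - Real.arctan 0)) ε) η
      (fun _ => gnoFolEmb y) := fun η y => by rw [← eθ']; exact hamb η y
  have hθθ : |(Real.pi / 2 - Real.arctan δ) - (Real.pi / 2 - Real.arctan 0)| ≤ |δ| := (abs_hubAngle_sub_le δ 0).trans (by rw [sub_zero])
  have hΔ' : (122689728 * |(Real.pi / 2 - Real.arctan δ) - (Real.pi / 2 - Real.arctan 0)| + 44712000 * ‖η - gnoBase p'.1 p'.2‖) * (L : ℝ) ^ 4 ≤ Δ := by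
    rw [hΔ]; gcongr
  have hlog := abs_log_det_gnoFolHessian_sub_le_joint (fun _ => false) (fun _ => (1 : SU2)) (sin_hubAngle_pos δ).le (sin_hubAngle_pos 0).le ε hAs hFs
    hambθ hambθ' hμ0 (gnoFolHessian_coercive_base (hubAt_one_ne_zero 0) ε hε.1 hε.2 p'.1 p'.2 hray) (hΔ'.trans hnear)
  set K : ℝ := (3 * (Fintype.card (Fol L) : ℝ)) * Δ / μ with hK
  have hlogK : |Real.log (LinearMap.det (A η)) - Real.log (LinearMap.det (AF (gnoBase p'.1 p'.2)))| ≤ 2 * K := by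
    refine hlog.trans ?_
    rw [hK]
    have hc0 : (0 : ℝ) ≤ 3 * (Fintype.card (Fol L) : ℝ) := by positivity
    have e : 2 * (3 * (Fintype.card (Fol L) : ℝ)) *
        ((122689728 * |(Real.pi / 2 - Real.arctan δ) - (Real.pi / 2 - Real.arctan 0)| + 44712000 * ‖η - gnoBase p'.1 p'.2‖) * (L : ℝ) ^ 4) / μ =
        2 * ((3 * (Fintype.card (Fol L) : ℝ)) *
          ((122689728 * |(Real.pi / 2 - Real.arctan δ) - (Real.pi / 2 - Real.arctan 0)| + 44712000 * ‖η - gnoBase p'.1 p'.2‖) * (L : ℝ) ^ 4) / μ) := by ring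
    rw [e]
    exact mul_le_mul_of_nonneg_left (div_le_div_of_nonneg_right (mul_le_mul_of_nonneg_left hΔ' hc0) hμ0.le) (by norm_num)
  -- `(√det A η)⁻¹ ≤ e^{K} (√det AF(gnoBase p′))⁻¹`
  have hkey : (Real.sqrt (LinearMap.det (A η)))⁻¹ ≤ Real.exp K * (Real.sqrt (LinearMap.det (AF (gnoBase p'.1 p'.2))))⁻¹ := by
    have e1 : (Real.sqrt (LinearMap.det (A η)))⁻¹ = Real.exp (-(Real.log (LinearMap.det (A η)) / 2)) := by
      rw [Real.sqrt_eq_rpow, Real.rpow_def_of_pos hdpos, ← Real.exp_neg]; ring_nf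
    have e2 : Real.exp K * (Real.sqrt (LinearMap.det (AF (gnoBase p'.1 p'.2))))⁻¹ = Real.exp (K + -(Real.log (LinearMap.det (AF (gnoBase p'.1 p'.2))) / 2)) := by
      rw [Real.sqrt_eq_rpow, Real.rpow_def_of_pos hdpos', ← Real.exp_neg, ← Real.exp_add]; ring_nf
    rw [e1, e2, Real.exp_le_exp]
    have h2 := (abs_le.1 hlogK).1
    linarith
  have eK : Real.exp ((3 * (Fintype.card (Fol L) : ℝ)) * ((122689728 * |δ| + 44712000 * ‖η - gnoBase p'.1 p'.2‖) * (L : ℝ) ^ 4) /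
      (2304 * (L : ℝ) ^ 6 * (Fintype.card (Fol L) : ℝ))⁻¹) = Real.exp K := by rw [hK]
  rw [eK]
  calc ENNReal.ofReal ((Real.sqrt (LinearMap.det (A η)))⁻¹) ≤ ENNReal.ofReal (Real.exp K * (Real.sqrt (LinearMap.det (AF (gnoBase p'.1 p'.2))))⁻¹) :=
        ENNReal.ofReal_le_ofReal hkey
    _ = ENNReal.ofReal (Real.exp K) * ENNReal.ofReal ((Real.sqrt (LinearMap.det (AF (gnoBase p'.1 p'.2))))⁻¹) := ENNReal.ofReal_mul (Real.exp_pos K).le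

end Summit.QuantumFields.YangMills.Theorems.SwapVirialDeficit.SectorLaplace

end
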